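import Mathlib
import HarnessLib.Audit
import Summits.PneNP.PneNP.Theorems.PstarUnionCaseB
import Summits.PneNP.PneNP.Theorems.PstarUnionRankSix

/-!
# Case B, the reversed containment: a chord-blind pinned reader is constant on every sheet (ROUND-24, memo §14.24; B9)

FRONTIER range-avoidance ladder, rung F-N3, ROUND 24 (cell `pnp-ideate`, planner memo `r24/CORE-BOUND-NOTES.md` §14.21–§14.24 "CASE B ↔ DIRECTION PICTURE DICTIONARY —
the containment is REVERSED and per chord there are only EQ / EXC, never NOR" (planner p3 g22, STATUS 20:35:02Z); restricted-model proof complexity — nothing here bears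
on `P` versus `NP`).

Normal form of Case B (after B-I/B-II): bridge data `B` for a pair `(R, w₂)` — `R = (C₁, G₁, b₁)` an effective reader that is CHORD-BLIND (no private in `C₁`) and gate-free,
`w₂ = (C₂, G₂, b₂)` gate-free and READING a literal of the chord `c` — with (T3) and the lift property.

* `reader_fails_on_sheet` — instance level: a solution of `J₀ − c` under which `c` holds with its pair at `(0,0)` has `R ≠ b₁` (B7 moves it into `Z` through `c`'s pair,
  which `R` does not see; (T3));
* `free₁_on_sheet` — **B9, bridge level**: `u_c(a) = 0 ⟹ free₁ a = b₁ + 1` — the SHEET `Z(m_c)` lies in a level set of the reader's form: the (★★) containment with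
  reader and chord swapped;
* `reader_cases_of_sheet` — hence `PstarRankRigidityFour.classification (q := m_c, g := free₁ + b₁ + 1)`: the reader's form is CONSTANT, or `= m_c + const` (EQ), or EXC
  (`g` or `m_c + g` a product of two affine functions); the NOR shape is excluded because `m_c` has rank `≥ 4` (`PstarChordBridgeForcing.rank_four_of_wf`).
-/

set_option linter.dupNamespace false -- `Summit.PneNP.PneNP.…`: summit = sub-problem name (D-0017 single-conjunct layout)

open Finset Module Literature.Computability.Complexity
open Summit.PneNP.PneNP.Theorems.PstarFibrePolys (bit bit_injective)
open Summit.PneNP.PneNP.Theorems.PstarTyped (Typed)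
open Summit.PneNP.PneNP.Theorems.PstarSALevel (varSet bdry BoundaryExpanding SimpleOverlap)
open Summit.PneNP.PneNP.Theorems.PstarGapOneAll (gval)
open Summit.PneNP.PneNP.Theorems.PstarXCore (xverts)
open Summit.PneNP.PneNP.Theorems.PstarCubeIdeals (IsAffineFn IsQuadFn)
open Summit.PneNP.PneNP.Theorems.PstarQuadRank (rad)
open Summit.PneNP.PneNP.Theorems.PstarForcing (exists_ne_of_rank_four not_rank_four_of_mul)
open Summit.PneNP.PneNP.Theorems.PstarProductRank (qform polar)
open Summit.PneNP.PneNP.Theorems.PstarRankRigidityFour (classification)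
open Summit.PneNP.PneNP.Theorems.PstarChordRepair (IsChord)
open Summit.PneNP.PneNP.Theorems.PstarChordBridgeTools
open Summit.PneNP.PneNP.Theorems.PstarChordBridge
open Summit.PneNP.PneNP.Theorems.PstarChordBridgeForcing (gam sys_u_eq qform_add' rank_four_of_wf free_add freePolar coef_of_unread)
open Summit.PneNP.PneNP.Theorems.PstarUnion (SatPair)
open Summit.PneNP.PneNP.Theorems.PstarUnionAtoms (Untouched gval_setPair)
open Summit.PneNP.PneNP.Theorems.PstarUnionCaseB (exists_Z_of_sheet eval_setPair_of_ne eval_setPair_self)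
open Summit.PneNP.PneNP.Theorems.PstarUnionRankSix (isAffineFn_polar_left)

namespace Summit.PneNP.PneNP.Theorems.PstarUnionCaseBSheet

variable {n m : ℕ}

/-! ## Instance level -/

/-- **A chord-blind pinned reader fails on the sheet.**  `w₂` reads a literal of the chord `c` (gate-free), `R` does not touch the privates of `c`, `(R, w₂)` is unsolvable
over `J₀`; then every solution of `J₀ − c` under which `c` holds with its private pair at `(0,0)` has `R ≠ b_R`. -/
theorem reader_fails_on_sheet (I : LocalMap 4 n m) (hI : I.IsPure xorAndPred) {y : Fin m → Bool} {J₀ : Finset (Fin m)} {c : Fin m}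
    (hc : c ∈ J₀) (hch : IsChord I J₀ c) (w₂ R : Finset (Fin n) × Finset (Fin m) × Bool)
    (hg : ∀ g ∈ w₂.2.1, I.vars g 2 ≠ I.vars c 2 ∧ I.vars g 3 ≠ I.vars c 2 ∧ I.vars g 2 ≠ I.vars c 3 ∧ I.vars g 3 ≠ I.vars c 3)
    (hread : I.vars c 2 ∈ w₂.1 ∨ I.vars c 3 ∈ w₂.1) (hR : Untouched I R (I.vars c 2) ∧ Untouched I R (I.vars c 3))
    (hT3 : ¬ SatPair I y J₀ R w₂) {x : Fin n → Bool} (hx : ∀ j ∈ J₀, j ≠ c → I.eval x j = y j)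
    (h0 : I.eval (Function.update (Function.update x (I.vars c 2) false) (I.vars c 3) false) c = y c) :
    gval I R.1 R.2.1 x ≠ R.2.2 := by
  intro hRx
  obtain ⟨a, b, -, hsol, hw⟩ := exists_Z_of_sheet I hI hc hch w₂ hg hread hx h0
  exact hT3 ⟨_, hsol, by rw [gval_setPair I hR x a b]; exact hRx, hw⟩

/-! ## Bridge level -/

/-- **B9 — the sheet lies in a level set of the reader.**  Bridge data for `(R, w₂)`: `R` chord-blind and gate-free, `w₂` gate-free and reading a literal of the chord `c`,
(T3), lift.  Then `u_c(a) = 0 ⟹ free₁ a = b₁ + 1`. -/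
theorem free₁_on_sheet (I : LocalMap 4 n m) (hI : I.IsPure xorAndPred) (hT : Typed I) {B : BridgeData n m} (hW : B.WF I) (hL : Lift I B)
    (hun : ∀ v ∈ privs I B.N, (∀ g ∈ B.G₁, I.vars g 2 ≠ v ∧ I.vars g 3 ≠ v) ∧ ∀ g ∈ B.G₂, I.vars g 2 ≠ v ∧ I.vars g 3 ≠ v)
    (hblind₁ : ∀ v ∈ privs I B.N, v ∉ B.C₁) (hT3 : ¬ ∃ z, Solution I B B.J₀ z)
    {c : Fin m} (hc : c ∈ B.N) (hread : I.vars c 2 ∈ B.C₂ ∨ I.vars c 3 ∈ B.C₂)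
    {a : Fin n → ZMod 2} (ha : uval I B.y (B.D c) c a = 0) :
    free I B.y (B.J₀ \ B.N) B.N B.T₁ B.C₁ B.G₁ a = bit B.b₁ + 1 := by
  classical
  have hcJ : c ∈ B.J₀ := hW.hN hc
  have hch := hW.hchord c hc
  -- lift the base point; chords other than `c` ON/OFF as prescribed, `c` at `(0,0)`
  obtain ⟨z₁, hz₁, hz₁x⟩ := hL fun v => toBool (a v)
  set s : Fin m → Bool × Bool := fun e => if e = c then (false, false) else (toBool ((sys I B).u e a), toBool ((sys I B).u e a)) with hs
  set z : Fin n → Bool := setPriv I B.N s z₁ with hz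
  have hzF : ∀ j ∈ B.J₀ \ B.N, I.eval z j = B.y j := fun j hj => by
    rw [hz, eval_setPriv_of_mem_sdiff I hW.hN hW.hchord s z₁ hj]; exact hz₁ j hj
  have hagree : ∀ v, v ∉ xverts I (B.J₀ \ B.N) → v ∉ privs I B.N → (fun v => bit (z v)) v = a v := by
    intro v hvx hvp
    show bit (z v) = a v
    rw [hz, setPriv_of_not_mem I s z₁ hvp, hz₁x v hvx, bit_toBool]
  have hu : ∀ e ∈ B.N, (sys I B).u e (fun v => bit (z v)) = (sys I B).u e a := fun e he => by
    rw [sys_u, sys_u]; exact uval_congr I hT hW he hagree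
  have h2 : ∀ e ∈ B.N, z (I.vars e 2) = (s e).1 := fun e he => by rw [hz]; exact setPriv_two I hW.hN hW.hchord s z₁ he
  have h3 : ∀ e ∈ B.N, z (I.vars e 3) = (s e).2 := fun e he => by rw [hz]; exact setPriv_three I hI hW.hN hW.hchord s z₁ he
  have hsc : s c = (false, false) := by rw [hs]; exact if_pos rfl
  -- every output holds at `z` (for `c`: `0 · 0 = u_c(a) = 0`)
  have hzJ : ∀ j ∈ B.J₀, I.eval z j = B.y j := by
    intro j hj
    by_cases hjN : j ∈ B.N
    · rw [eval_iff_adm I hI hW hzF hjN, h2 j hjN, h3 j hjN, hu j hjN, hs]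
      dsimp only
      by_cases hjc : j = c
      · rw [if_pos hjc, hjc, sys_u, ha]; decide
      · rw [if_neg hjc]
        dsimp only
        rw [bit_toBool]
        generalize (sys I B).u j a = t
        revert t; decide
    · exact hzF j (mem_sdiff.2 ⟨hj, hjN⟩)
  -- `c` holds with its pair at `(0,0)`: it already is at `(0,0)`
  have hzc2 : z (I.vars c 2) = false := by rw [h2 c hc, hsc]
  have hzc3 : z (I.vars c 3) = false := by rw [h3 c hc, hsc]
  have h0 : I.eval (Function.update (Function.update z (I.vars c 2) false) (I.vars c 3) false) c = B.y c := by
    have e1 : Function.update z (I.vars c 2) false = z := by rw [← hzc2, Function.update_eq_self]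
    have e2 : Function.update z (I.vars c 3) false = z := by rw [← hzc3, Function.update_eq_self]
    rw [e1, e2]; exact hzJ c hcJ
  -- the reader does not touch the pair, so it fails at `z`
  have hp2 : I.vars c 2 ∈ privs I B.N := vars_mem_privs I hc (s := 2) (by decide)
  have hp3 : I.vars c 3 ∈ privs I B.N := vars_mem_privs I hc (s := 3) (by decide)
  have hR : Untouched I (B.C₁, B.G₁, B.b₁) (I.vars c 2) ∧ Untouched I (B.C₁, B.G₁, B.b₁) (I.vars c 3) :=
    ⟨⟨hblind₁ _ hp2, (hun _ hp2).1⟩, ⟨hblind₁ _ hp3, (hun _ hp3).1⟩⟩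
  have hg : ∀ g ∈ B.G₂, I.vars g 2 ≠ I.vars c 2 ∧ I.vars g 3 ≠ I.vars c 2 ∧ I.vars g 2 ≠ I.vars c 3 ∧ I.vars g 3 ≠ I.vars c 3 :=
    fun g hg' => ⟨((hun _ hp2).2 g hg').1, ((hun _ hp2).2 g hg').2, ((hun _ hp3).2 g hg').1, ((hun _ hp3).2 g hg').2⟩
  have hT3' : ¬ SatPair I B.y B.J₀ (B.C₁, B.G₁, B.b₁) (B.C₂, B.G₂, B.b₂) := fun ⟨x, hx, h1, h2⟩ => hT3 ⟨x, hx, h1, h2⟩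
  have hfail := reader_fails_on_sheet I hI hcJ hch (B.C₂, B.G₂, B.b₂) (B.C₁, B.G₁, B.b₁) hg hread hR hT3' (fun j hj _ => hzJ j hj) h0
  -- translate `gval R z` into `free₁ a`
  have hval : bit (gval I B.C₁ B.G₁ z) = free I B.y (B.J₀ \ B.N) B.N B.T₁ B.C₁ B.G₁ a := by
    rw [bit_gval_eq I hI hT hW.hN hW.hchord B.y hW.hT₁ B.C₁ B.G₁ hW.hjoin₁ hW.hcross₁ hzF,
      free_congr I hT hW hW.hT₁ B.C₁ B.G₁ hagree, sum_eq_zero fun e he => ?_, add_zero]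
    rw [coef_of_unread I (hun _ (vars_mem_privs I he (s := 2) (by decide))).1, if_neg (hblind₁ _ (vars_mem_privs I he (s := 2) (by decide))),
      coef_of_unread I (hun _ (vars_mem_privs I he (s := 3) (by decide))).1, if_neg (hblind₁ _ (vars_mem_privs I he (s := 3) (by decide))),
      mul_zero, mul_zero, add_zero]
  rw [← hval]
  have e : ∀ s t : Bool, s ≠ t → bit s = bit t + 1 := by decide
  exact e _ _ hfail

/-- **The reader's cases on a chord (Case B).**  Under the hypotheses of `free₁_on_sheet` on a pure `(r,3/2)`-expanding instance with simple overlaps (`#J₀ ≤ r`): with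
`g := free₁ + b₁ + 1` and `m_c := u_c` (polar form `polar (D c)`, rank `≥ 4`), either `g ≡ 0` (the reader is CONSTANT), or `g = m_c` (EQ), or `g` resp. `m_c + g` is a
product of two affine functions (EXC). -/
theorem reader_cases_of_sheet (I : LocalMap 4 n m) (hI : I.IsPure xorAndPred) (hT : Typed I) (hS : SimpleOverlap I) {r : ℕ} (hE : BoundaryExpanding r I)
    {B : BridgeData n m} (hW : B.WF I) (hr : B.J₀.card ≤ r) (hL : Lift I B)
    (hun : ∀ v ∈ privs I B.N, (∀ g ∈ B.G₁, I.vars g 2 ≠ v ∧ I.vars g 3 ≠ v) ∧ ∀ g ∈ B.G₂, I.vars g 2 ≠ v ∧ I.vars g 3 ≠ v)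
    (hblind₁ : ∀ v ∈ privs I B.N, v ∉ B.C₁) (hT3 : ¬ ∃ z, Solution I B B.J₀ z)
    {c : Fin m} (hc : c ∈ B.N) (hread : I.vars c 2 ∈ B.C₂ ∨ I.vars c 3 ∈ B.C₂) :
    (∀ x, free I B.y (B.J₀ \ B.N) B.N B.T₁ B.C₁ B.G₁ x + bit B.b₁ + 1 = 0) ∨
    (∀ x, free I B.y (B.J₀ \ B.N) B.N B.T₁ B.C₁ B.G₁ x + bit B.b₁ + 1 = uval I B.y (B.D c) c x) ∨
    (∃ μ₁ μ₂ : (Fin n → ZMod 2) → ZMod 2, IsAffineFn μ₁ ∧ IsAffineFn μ₂ ∧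
      ((∀ x, free I B.y (B.J₀ \ B.N) B.N B.T₁ B.C₁ B.G₁ x + bit B.b₁ + 1 = μ₁ x * μ₂ x) ∨
       (∀ x, uval I B.y (B.D c) c x + (free I B.y (B.J₀ \ B.N) B.N B.T₁ B.C₁ B.G₁ x + bit B.b₁ + 1) = μ₁ x * μ₂ x))) := by
  classical
  have hu : ∀ x, uval I B.y (B.D c) c x = gam B c + qform (B.D c) (fun j => I.vars j 2) (fun j => I.vars j 3) x := fun x => by
    rw [← sys_u]; exact sys_u_eq I B c x
  -- `m_c` is quadratic with polar form `polar (D c)`, of rank ≥ 4, hence non-constant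
  have hBq : ∀ x w, uval I B.y (B.D c) c (x + w) = uval I B.y (B.D c) c x + uval I B.y (B.D c) c w + uval I B.y (B.D c) c 0
      + polar (B.D c) (fun j => I.vars j 2) (fun j => I.vars j 3) x w := by
    intro x w
    rw [hu, hu, hu, hu, qform_add' I (B.D c)]
    generalize qform (B.D c) (fun j => I.vars j 2) (fun j => I.vars j 3) x = s
    generalize qform (B.D c) (fun j => I.vars j 2) (fun j => I.vars j 3) w = s'
    generalize qform (B.D c) (fun j => I.vars j 2) (fun j => I.vars j 3) (0 : Fin n → ZMod 2) = s₀
    generalize polar (B.D c) (fun j => I.vars j 2) (fun j => I.vars j 3) x w = t; generalize gam B c = g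
    revert s s' s₀ t g; decide
  have hrank := rank_four_of_wf I hI hS hE hW hr hc
  have hq : ∃ v, uval I B.y (B.D c) c v ≠ uval I B.y (B.D c) c 0 := exists_ne_of_rank_four hBq hrank
  -- the reader's shifted form is quadratic and vanishes on the sheet
  have hg : IsQuadFn fun x => free I B.y (B.J₀ \ B.N) B.N B.T₁ B.C₁ B.G₁ x + bit B.b₁ + 1 := by
    refine ⟨freePolar I B.N B.T₁ B.G₁, fun x w => ?_⟩
    show free I B.y (B.J₀ \ B.N) B.N B.T₁ B.C₁ B.G₁ (x + w) + bit B.b₁ + 1 =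
      (free I B.y (B.J₀ \ B.N) B.N B.T₁ B.C₁ B.G₁ x + bit B.b₁ + 1) + (free I B.y (B.J₀ \ B.N) B.N B.T₁ B.C₁ B.G₁ w + bit B.b₁ + 1)
        + (free I B.y (B.J₀ \ B.N) B.N B.T₁ B.C₁ B.G₁ 0 + bit B.b₁ + 1) + freePolar I B.N B.T₁ B.G₁ x w
    rw [free_add]
    generalize free I B.y (B.J₀ \ B.N) B.N B.T₁ B.C₁ B.G₁ x = s; generalize free I B.y (B.J₀ \ B.N) B.N B.T₁ B.C₁ B.G₁ w = s'
    generalize free I B.y (B.J₀ \ B.N) B.N B.T₁ B.C₁ B.G₁ 0 = s₀; generalize freePolar I B.N B.T₁ B.G₁ x w = t; generalize bit B.b₁ = b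
    revert s s' s₀ t b; decide
  have hZ : ∀ x, uval I B.y (B.D c) c x = 0 → (fun x => free I B.y (B.J₀ \ B.N) B.N B.T₁ B.C₁ B.G₁ x + bit B.b₁ + 1) x = 0 := by
    intro x hx
    show free I B.y (B.J₀ \ B.N) B.N B.T₁ B.C₁ B.G₁ x + bit B.b₁ + 1 = 0
    rw [free₁_on_sheet I hI hT hW hL hun hblind₁ hT3 hc hread hx]
    generalize bit B.b₁ = b; revert b; decide
  rcases classification hBq hq hg hZ with h | h | ⟨a, b, -, hqf, -⟩
  · rcases h with h | h
    · exact Or.inl h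
    · exact Or.inr (Or.inl h)
  · exact Or.inr (Or.inr h)
  · -- NOR: `m_c` a product plus one — rank ≤ 2, contradiction
    exact (not_rank_four_of_mul hBq (isAffineFn_polar_left _ b _) (isAffineFn_polar_left _ a _) (κ := 1) hqf hrank).elim

end Summit.PneNP.PneNP.Theorems.PstarUnionCaseBSheet
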